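import Summits.FinalStateConjecture.FinalStateConjecture.Theorems.SwallowTheDatumUniversalWitnessFamilyRegionOneHoleLate
import Summits.FinalStateConjecture.FinalStateConjecture.Theorems.SwallowTheDatumUniversalWitnessFamilyRegionOneExterior
import Summits.FinalStateConjecture.FinalStateConjecture.Statement

/-!
# Crux `SwallowTheDatum.UniversalWitnessFamily` (stmt-FinalStateConjecture-10051), line `Sketch`,
# stub `stub_regionOneDecomposition` — part 9: the explicit `N = 1` decomposition of region I

Assembly of the registered stub `stub_regionOneDecomposition` of the line: in the Schwarzschild exterior
spacetime `Kerr.spacetime M 0 (2M)` (`{r > 2M}` in ingoing Kerr–Schild coordinates, `M > 0`) with the static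
slice `Σ₀ = range ψ`, the region `O = {t ≥ 0} = J⁺(Σ₀) = J⁺(Σ₀) ∩ I⁻(charted)` carries a `C²` final state
decomposition with ONE hole of mass `M`, spin `0`, motion `(1, 0)` and `HasExhaustiveCharts`:

* hole chart `y ↦ holeMap M T₀ y` on the boosted Kerr exterior (exact isometry on the growing near zone
  `{r ≤ S(t*)}`, parts 6 and 8), certified radii `R = certRadius M < S`;
* flat chart `x ↦ outMap M x` (outgoing Kerr–Schild coordinates) on
  `U₀ = {x⁰ > T₀ + 1, ‖x̃‖ > ρ(x⁰)}`, `ρ = excision M = o(t)`, converging to `η` in `C²` (part 7);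
* covering clauses (`diff_subset_causalPast`, `O = J⁺(Σ₀) ∩ I⁻(charted)`, exhaustion at every chart time
  `τ₁`) by the future-directed orbits `s ↦ p + s e₀` of the static Killing field (part 3) and the real
  case analysis `exhaustion_cases` (no annulus is left uncertified because `ρ < R`, `R ≥ 4M`, `ρ, R` monotone).

References: Dafermos–Luk arXiv:1710.01722, Conjecture 1; DHRT arXiv:2104.08222, §1; Christodoulou–Klainerman
1993, Thm. 1.0.2; O'Neill 1983, Ch. 13–14; Misner–Thorne–Wheeler 1973, §31.4.

Maintenance note (full-build repair 2026-08-17, statement of `stub_regionOneDecomposition` unchanged). The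
registry predicate `Summit.FinalStateConjecture.HasExhaustiveCharts` gained a first clause with the statement
re-type of 2026-08-16: the near-zone radii must tend to infinity and dominate the horizon radius,
`∀ i, Tendsto (R i) atTop atTop ∧ ∀ τ, max (r₊(Mᵢ, aᵢ)) 0 + 1 ≤ R i τ`. The witness radii are now
`R(τ) = certRadius M τ + 1` (`→ ∞` with `growth M`; `≥ 4M + 1 ≥ r₊(M, 0) + 1 = 2M + 1`; eventually below the
exact-zone radius `exactRadius M τ = certRadius M τ + 2 growth M τ`, which is all the deviation clause needs);
the covering clause is proved for the original radii `certRadius M` exactly as before and transported to the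
larger radii by the monotonicity of the certified regions in `R` (`certifiedLate_mono`, `certifiedSlab_mono`,
`J⁻` monotone).
-/

set_option linter.dupNamespace false

noncomputable section

open scoped Manifold ContDiff Topology
open Set Function Filter Literature.Geometry.Lorentzian

namespace Summit.FinalStateConjecture.FinalStateConjecture.Theorems.SwallowTheDatum.UniversalWitnessFamily

/-! ## Images of the flat chart -/

section FlatImages

variable {M T₀ : ℝ} {U : TopologicalSpace.Opens E4}
  (hU : ∀ x, x ∈ U ↔ T₀ + 1 < x 0 ∧ excision M (x 0) < E4.spatialNorm x)
  (flat : (Minkowski.backgroundOn U).domain → Kerr.region 0 (Kerr.rPlus M 0))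
  (hflat : ∀ y, (flat y : E4) = outMap M y)

include hU hflat in
/-- A point `p` of the exterior with outgoing time `p⁰ − 2 torH ‖p̃‖ > T₀ + 1` outside the excised tube is the
flat image of `(p⁰ − 2 torH ‖p̃‖, p̃)`. -/
theorem mem_image_flatChart {A : Set (Minkowski.backgroundOn U).domain} (p : Kerr.region 0 (Kerr.rPlus M 0))
    (h0 : T₀ + 1 < p.1 0 - 2 * torH M (E4.spatialNorm p.1))
    (hr : excision M (p.1 0 - 2 * torH M (E4.spatialNorm p.1)) < E4.spatialNorm p.1)
    (hA : ∀ y : (Minkowski.backgroundOn U).domain,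
      y.1 = p.1 + (-(2 * torH M (E4.spatialNorm p.1))) • E4.basisVector 0 → y ∈ A) :
    p ∈ flat '' A := by
  set y : E4 := p.1 + (-(2 * torH M (E4.spatialNorm p.1))) • E4.basisVector 0 with hy
  have hyr : E4.spatialNorm y = E4.spatialNorm p.1 := spatialNorm_add_smul_basisVector _ _
  have hy0 : y 0 = p.1 0 - 2 * torH M (E4.spatialNorm p.1) := by rw [hy]; simp; ring
  have hyU : y ∈ (Minkowski.backgroundOn U).domain := by
    show y ∈ U
    rw [hU, hy0, hyr]; exact ⟨h0, hr⟩
  refine ⟨⟨y, hyU⟩, hA ⟨y, hyU⟩ rfl, Subtype.ext ?_⟩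
  rw [hflat]
  show outMap M y = p.1
  rw [outMap_eq, hyr, hy, add_assoc, ← add_smul, neg_add_cancel, zero_smul, add_zero]

include hU hflat in
/-- **Image of a late flat region**: `flat({x⁰ > τ₁}) = {p | τ₁ < p⁰ − 2 torH ‖p̃‖, ρ(p⁰ − 2 torH ‖p̃‖) < ‖p̃‖}`
for `τ₁ ≥ T₀ + 1`. -/
theorem image_flatChart_lateRegion {τ₁ : ℝ} (hτ₁ : T₀ + 1 ≤ τ₁) :
    flat '' (Minkowski.backgroundOn U).lateRegion τ₁ =
      {p | τ₁ < p.1 0 - 2 * torH M (E4.spatialNorm p.1) ∧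
        excision M (p.1 0 - 2 * torH M (E4.spatialNorm p.1)) < E4.spatialNorm p.1} := by
  ext p
  constructor
  · rintro ⟨y, hy, rfl⟩
    have hyU := (hU y.1).1 y.2
    have hy1 : τ₁ < y.1 0 := hy
    show τ₁ < (flat y).1 0 - 2 * torH M (E4.spatialNorm (flat y).1) ∧
      excision M ((flat y).1 0 - 2 * torH M (E4.spatialNorm (flat y).1)) < E4.spatialNorm (flat y).1
    rw [hflat, outMap_apply_zero, spatialNorm_outMap, add_sub_cancel_right]
    exact ⟨hy1, hyU.2⟩
  · rintro ⟨h1, h2⟩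
    exact mem_image_flatChart hU flat hflat p (by linarith) h2 fun y hy ↦ by
      show τ₁ < y.1 0
      rw [hy]; simp; linarith

include hU hflat in
/-- **Image of a late flat slab**: `flat({x⁰ = τ₁}) = {p | p⁰ − 2 torH ‖p̃‖ = τ₁, ρ(τ₁) < ‖p̃‖}` for
`τ₁ > T₀ + 1`. -/
theorem image_flatChart_timeSlab {τ₁ : ℝ} (hτ₁ : T₀ + 1 < τ₁) :
    flat '' (Minkowski.backgroundOn U).timeSlab τ₁ =
      {p | p.1 0 - 2 * torH M (E4.spatialNorm p.1) = τ₁ ∧ excision M τ₁ < E4.spatialNorm p.1} := by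
  ext p
  constructor
  · rintro ⟨y, hy, rfl⟩
    have hyU := (hU y.1).1 y.2
    have hy1 : y.1 0 = τ₁ := hy
    show (flat y).1 0 - 2 * torH M (E4.spatialNorm (flat y).1) = τ₁ ∧ excision M τ₁ < E4.spatialNorm (flat y).1
    rw [hflat, outMap_apply_zero, spatialNorm_outMap, add_sub_cancel_right, ← hy1]
    exact ⟨rfl, hyU.2⟩
  · rintro ⟨h1, h2⟩
    exact mem_image_flatChart hU flat hflat p (by linarith) (by rw [h1]; exact h2) fun y hy ↦ by
      show y.1 0 = τ₁
      rw [hy]; simp; linarith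

end FlatImages

/-! ## The real case analysis of the exhaustion clause -/

/-- **Exhaustion at chart time `τ₁`, as real arithmetic.** For a point with ingoing time `T`, radius
`r > 2M`, outgoing time `T − 2 torH r`, which is neither flat-certified (`τ₁ < T − 2torH r ∧ ρ(T − 2torH r) < r`)
nor hole-certified (`τ₁ < T ∧ r ≤ R(T)`), some future translate by `s ≥ 0` along `∂_{t*}` lies on the certified
slab: either on the flat slab (`T + s − 2 torH r = τ₁`, `ρ(τ₁) < r`) or on the truncated hole slab
(`T + s = τ₁`, `r ≤ R(τ₁)`). Uses `ρ < R`, `4M ≤ R`, `torH ≥ 0 ⇔ r ≥ 4M`, and the monotonicity of `ρ, R`. -/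
theorem exhaustion_cases {M : ℝ} (hM : 0 < M) {τ₁ T r : ℝ} (hτ₁ : 0 ≤ τ₁)
    (hnf : ¬(τ₁ < T - 2 * torH M r ∧ excision M (T - 2 * torH M r) < r))
    (hnh : ¬(τ₁ < T ∧ r ≤ certRadius M T)) :
    ∃ s : ℝ, 0 ≤ s ∧ ((T + s - 2 * torH M r = τ₁ ∧ excision M τ₁ < r) ∨ (T + s = τ₁ ∧ r ≤ certRadius M τ₁)) := by
  by_cases hA : T - 2 * torH M r ≤ τ₁
  · by_cases hr : excision M τ₁ < r
    · exact ⟨τ₁ - (T - 2 * torH M r), by linarith, Or.inl ⟨by ring, hr⟩⟩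
    · have hrR : r ≤ certRadius M τ₁ := (not_lt.1 hr).trans (excision_lt_certRadius hM τ₁).le
      by_cases hT : T ≤ τ₁
      · exact ⟨τ₁ - T, by linarith, Or.inr ⟨by ring, hrR⟩⟩
      · exact absurd ⟨lt_of_not_ge hT, hrR.trans (certRadius_le_certRadius hM hτ₁ (le_of_not_ge hT))⟩ hnh
  · have hB : r ≤ excision M (T - 2 * torH M r) := not_lt.1 fun h ↦ hnf ⟨lt_of_not_ge hA, h⟩
    by_cases hT : T ≤ τ₁
    · have htor : torH M r < 0 := by linarith [lt_of_not_ge hA]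
      have hr4 : r < 4 * M := lt_of_not_ge fun h4 ↦ (torH_nonneg hM h4).not_gt htor
      exact ⟨τ₁ - T, by linarith, Or.inr ⟨by ring, by linarith [four_mul_le_certRadius hM τ₁]⟩⟩
    · refine absurd ⟨lt_of_not_ge hT, ?_⟩ hnh
      by_cases h4 : 4 * M ≤ r
      · have ht0 : 0 ≤ torH M r := torH_nonneg hM h4
        calc r ≤ excision M (T - 2 * torH M r) := hB
          _ ≤ excision M T := excision_le_excision hM (by linarith [lt_of_not_ge hA]) (by linarith)
          _ ≤ certRadius M T := (excision_lt_certRadius hM T).le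
      · linarith [four_mul_le_certRadius hM T]

/-! ## Monotonicity of the certified regions in the near-zone radii -/

/-- The certified late region grows with the near-zone radii. [folklore] -/
theorem certifiedLate_mono {𝓢 : Spacetime.{0} 4} {O' : Set 𝓢.carrier} {k : ℕ}
    (d : FinalStateDecomposition 𝓢 O' k) {R R' : Fin d.N → ℝ → ℝ} (h : ∀ i τ, R i τ ≤ R' i τ) (τ₁ : ℝ) :
    certifiedLate d R τ₁ ⊆ certifiedLate d R' τ₁ :=
  Set.union_subset_union_right _ (Set.iUnion_mono fun i ↦ Set.image_mono fun _ hx ↦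
    ⟨hx.1, hx.2.trans (h i _)⟩)

/-- The certified slab grows with the near-zone radii. [folklore] -/
theorem certifiedSlab_mono {𝓢 : Spacetime.{0} 4} {O' : Set 𝓢.carrier} {k : ℕ}
    (d : FinalStateDecomposition 𝓢 O' k) {R R' : Fin d.N → ℝ → ℝ} (h : ∀ i τ, R i τ ≤ R' i τ) (τ₁ : ℝ) :
    certifiedSlab d R τ₁ ⊆ certifiedSlab d R' τ₁ :=
  Set.union_subset_union_right _ (Set.iUnion_mono fun i ↦ Set.image_mono fun _ hx ↦
    ⟨hx.1, hx.2.trans (h i τ₁)⟩)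

/-! ## The decomposition -/

/-- **Stub M2 of line `Sketch` (`stub_regionOneDecomposition`): the explicit `N = 1` final state
decomposition of the Schwarzschild exterior.** In `Kerr.spacetime M 0 (2M)` with the static slice
`Σ₀ = range ψ`, the region `O = J⁺(Σ₀) ∩ I⁻(charted)` (`= {t ≥ 0}`) carries a `C²` final state decomposition with
one sub-extremal hole (`M`, spin `0`, motion `(1, 0)`) and exhaustive charts: hole chart `holeMap M T₀`
(identity isometry on the growing near zone `{r ≤ S(t*)}`, `S = exactRadius M`; certified radii
`R = certRadius M`), flat chart `outMap M` (outgoing Kerr–Schild coordinates) on `{x⁰ > T₀ + 1, ‖x̃‖ > ρ(x⁰)}`,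
`ρ = excision M`; covering by the static Killing orbits. [cite: DafermosLuk2017, Conjecture 1 (b)–(c)]
[cite: arXiv210408222, §1] [cite: ChristodoulouKlainerman1993, Thm. 1.0.2] [cite: ONeill1983, Ch. 13] -/
theorem stub_regionOneDecomposition :
  ∀ [Kerr.Facts] (M : ℝ) (hM : 0 < M)
    (ψ : Schwarzschild.isotropicExterior M → Kerr.region 0 (Kerr.rPlus M 0)),
    (∀ y, (ψ y : E4) =
      E4.ofTimeSpace (2 * M * Real.log (‖(y : E3)‖ * (1 + M / (2 * ‖(y : E3)‖)) ^ 2 / (2 * M) - 1))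
        ((1 + M / (2 * ‖(y : E3)‖)) ^ 2 • (y : E3))) →
    ∃ (O : Set (Kerr.region 0 (Kerr.rPlus M 0)))
      (dec : FinalStateDecomposition (Kerr.spacetime M 0 (Kerr.rPlus M 0) hM.le) O 2),
      (∀ i, Kerr.IsSubextremal (dec.mass i) (dec.spin i)) ∧
      O = (Kerr.smoothMetric M 0 (Kerr.rPlus M 0)).causalFuture
            ((Kerr.timeOrientation M 0 (Kerr.rPlus M 0) hM.le).ofLE le_top) (Set.range ψ) ∩
          (Kerr.smoothMetric M 0 (Kerr.rPlus M 0)).chronologicalPast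
            ((Kerr.timeOrientation M 0 (Kerr.rPlus M 0) hM.le).ofLE le_top) dec.charted ∧
      Summit.FinalStateConjecture.HasExhaustiveCharts dec := by
  intro _ M hM ψ hψ
  obtain ⟨T₀, -, hT0, hmono, htor⟩ := exists_lateTime hM
  obtain ⟨Θ, -, hΘs⟩ := exists_timeReflection
  -- the region `O = {t ≥ 0}`
  obtain ⟨O, hO⟩ : ∃ O : Set (Kerr.region 0 (Kerr.rPlus M 0)), O = {p | 0 ≤ staticTime M p.1} := ⟨_, rfl⟩
  have hJO : (Kerr.smoothMetric M 0 (Kerr.rPlus M 0)).causalFuture (ksTime hM.le) (Set.range ψ) = O := by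
    rw [hO]; exact causalFuture_range_sheet hM hψ
  -- the hole chart
  let Bh : ModelBackground := boostedKerrBackground 1 0 M 0
  let chart : Bh.domain → Kerr.region 0 (Kerr.rPlus M 0) :=
    fun y ↦ ⟨holeMap M T₀ y.1, holeMap_mem_region hM T₀ ((mem_holeDomain hM.le).1 y.2)⟩
  have hchart : ∀ y, (chart y : E4) = holeMap M T₀ y := fun _ ↦ rfl
  have hchart_late : chart '' Bh.lateRegion (T₀ + 1) ⊆ O := by
    rintro _ ⟨y, hy, rfl⟩
    have hy0 : T₀ + 1 < y.1 0 := mem_holeLateRegion.1 hy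
    have hyr : 2 * M < E4.spatialNorm y.1 := (mem_holeDomain hM.le).1 y.2
    rw [hO]
    show 0 ≤ staticTime M (holeMap M T₀ y.1)
    rw [holeMap_of_le M hy0.le, staticTime_bentMap]
    exact staticTime_bent_nonneg hM htor hT0.le (by linarith) hyr
  -- the flat chart
  let Ωf : TopologicalSpace.Opens E4 :=
    ⟨{x | 2 * M < E4.spatialNorm x}, isOpen_lt continuous_const (continuous_norm.comp E4.spatial.continuous)⟩
  have hΩf : ∀ x ∈ Ωf, 2 * M < E4.spatialNorm x := fun _ h ↦ h
  let Bf : ModelBackground := ⟨Ωf, fun x ↦ boostedKerrBilin Θ 0 M 0 x, fun x ↦ x 0, E4.spatialNorm⟩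
  let Φf : Bf.domain → Kerr.region 0 (Kerr.rPlus M 0) :=
    fun y ↦ ⟨outMap M y.1, outMap_mem_region hM (hΩf y.1 y.2)⟩
  have hΦf : ∀ y, (Φf y : E4) = outMap M y := fun _ ↦ rfl
  have hc0 : Continuous fun y : E4 ↦ y 0 := PiLp.continuous_apply 2 _ 0
  let U'' : TopologicalSpace.Opens E4 := ⟨{x | T₀ + 1 < x 0 ∧ excision M (x 0) < E4.spatialNorm x},
    (isOpen_lt continuous_const hc0).inter
      (isOpen_lt ((continuous_excision M).comp hc0) (continuous_norm.comp E4.spatial.continuous))⟩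
  have hU'' : ∀ x, x ∈ U'' ↔ T₀ + 1 < x 0 ∧ excision M (x 0) < E4.spatialNorm x := fun _ ↦ Iff.rfl
  have hU''4 : ∀ x ∈ U'', 4 * M < E4.spatialNorm x := fun x hx ↦ (four_mul_lt_excision hM (x 0)).trans hx.2
  have hle : (Minkowski.backgroundOn U'').domain ≤ Bf.domain := fun x hx ↦
    show 2 * M < E4.spatialNorm x by linarith [hU''4 x hx]
  let flat : (Minkowski.backgroundOn U'').domain → Kerr.region 0 (Kerr.rPlus M 0) :=
    Φf ∘ TopologicalSpace.Opens.inclusion hle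
  have hflat : ∀ y, (flat y : E4) = outMap M y := fun _ ↦ rfl
  have hflatΩ : ∀ x ∈ U'', 2 * M < E4.spatialNorm x := fun x hx ↦ hle hx
  have hflat_late : ∀ τ₁, T₀ + 1 ≤ τ₁ → flat '' (Minkowski.backgroundOn U'').lateRegion τ₁ ⊆ O := by
    rintro τ₁ hτ₁ _ ⟨y, hy, rfl⟩
    have hy1 : τ₁ < y.1 0 := hy
    rw [hO]
    show 0 ≤ staticTime M (outMap M y.1)
    have := le_staticTime_outMap hM (hU''4 y.1 y.2).le
    linarith
  -- vertical flows: `I⁻(hole late image) = everything`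
  have hflowI : ∀ p : Kerr.region 0 (Kerr.rPlus M 0),
      p ∈ (Kerr.smoothMetric M 0 (Kerr.rPlus M 0)).chronologicalPast (ksTime hM.le)
        (chart '' Bh.lateRegion (T₀ + 1)) := by
    intro p
    set f : ℝ := (T₀ + 1) + bend M (T₀ + 1) (E4.spatialNorm p.1) with hf
    set s : ℝ := max 1 (f - p.1 0 + 1) with hs
    have hs0 : 0 < s := lt_of_lt_of_le one_pos (le_max_left _ _)
    have hq : vert p s ∈ chart '' Bh.lateRegion (T₀ + 1) := by
      rw [image_holeChart_lateRegion chart hchart hM hmono]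
      show (T₀ + 1) + bend M (T₀ + 1) (E4.spatialNorm (vert p s).1) < (vert p s).1 0
      rw [spatialNorm_vert, vert_apply_zero, ← hf]
      have := le_max_right 1 (f - p.1 0 + 1)
      linarith
    exact LorentzianMetric.chronologicalFuture_mono (singleton_subset_iff.2 hq) (mem_chronologicalPast_vert hM p hs0)
  -- the decomposition
  let d : FinalStateDecomposition (Kerr.spacetime M 0 (Kerr.rPlus M 0) hM.le) O 2 :=
    { N := 1
      mass := fun _ ↦ M
      spin := fun _ ↦ 0
      mass_pos := fun _ ↦ hM
      abs_spin_le_mass := fun _ ↦ by rw [abs_zero]; exact hM.le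
      motion := fun _ ↦ (1, 0)
      τ₀ := T₀ + 1
      chart := fun _ ↦ chart
      isLateChart := fun _ ↦ ⟨contMDiff_holeChart chart hchart hM,
        isOpenEmbedding_restrict_holeChart chart hchart hM hmono, hchart_late⟩
      tendsto_truncDeviationCk := fun _ R ↦ tendsto_truncDeviationCk_holeChart chart hchart hM 2
        ((tendsto_exactRadius_atTop hM).eventually_gt_atTop R)
      exists_pairwise_disjoint := fun _ ↦ ⟨0, Subsingleton.pairwise⟩
      excision := fun _ ↦ excision M
      tendsto_excision_div := fun _ ↦ tendsto_excision_div_atTop hM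
      flatDomain := U''
      setOf_lt_excision_subset_flatDomain := fun x hx ↦ ⟨hx.1, by
        have := hx.2 0
        rwa [poincareInv_one_zero, Kerr.radius_zero_left] at this⟩
      flatChart := flat
      isLateChart_flat := ⟨(contMDiff_outChart hM hΩf Φf hΦf).comp (contMDiff_inclusion hle),
        isOpenEmbedding_restrict_outChart hM hflatΩ flat hflat
          (isOpen_lt continuous_const (hc0.comp continuous_subtype_val)),
        hflat_late (T₀ + 1) le_rfl⟩
      tendsto_deviationCk_flat := tendsto_deviationCk_outChart hM hΘs Bf rfl (fun _ ↦ rfl) (fun _ ↦ rfl) hΩf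
        Φf hΦf 2 (tendsto_excision_atTop hM) (W := U'') (fun z hz ↦ hz.2) hle
      diff_subset_causalPast := by
        intro p hp
        have hp2 : p ∉ chart '' Bh.lateRegion (T₀ + 1) := fun h ↦
          hp.2 (Or.inl (Set.mem_iUnion.mpr ⟨0, h⟩))
        rw [image_holeChart_lateRegion chart hchart hM hmono] at hp2
        have hle' : p.1 0 ≤ (T₀ + 1) + bend M (T₀ + 1) (E4.spatialNorm p.1) := le_of_not_gt hp2
        have hq : vert p ((T₀ + 1) + bend M (T₀ + 1) (E4.spatialNorm p.1) - p.1 0) ∈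
            chart '' Bh.timeSlab (T₀ + 1) := by
          rw [image_holeChart_timeSlab chart hchart hM le_rfl]
          show (vert p _).1 0 = (T₀ + 1) + bend M (T₀ + 1) (E4.spatialNorm (vert p _).1)
          rw [spatialNorm_vert, vert_apply_zero]; ring
        refine LorentzianMetric.causalFuture_mono ?_ (mem_causalPast_vert hM p (sub_nonneg.2 hle'))
        exact singleton_subset_iff.2 (Or.inl (Set.mem_iUnion.mpr ⟨0, hq⟩)) }
  -- exhaustion with the certified radii `R = certRadius M` of the construction
  have hexh : ∀ τ₁ : ℝ, T₀ + 1 < τ₁ → ∀ p, p ∈ O \ certifiedLate d (fun _ τ ↦ certRadius M τ) τ₁ →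
      p ∈ (Kerr.smoothMetric M 0 (Kerr.rPlus M 0)).causalPast (ksTime hM.le)
        (certifiedSlab d (fun _ τ ↦ certRadius M τ) τ₁) := by
    -- exhaustion at chart time `τ₁ > T₀ + 1`
    intro τ₁ hτ₁' p hp
    have hnf : ¬(τ₁ < p.1 0 - 2 * torH M (E4.spatialNorm p.1) ∧
        excision M (p.1 0 - 2 * torH M (E4.spatialNorm p.1)) < E4.spatialNorm p.1) := by
      intro h
      refine hp.2 (Or.inl ?_)
      change p ∈ flat '' (Minkowski.backgroundOn U'').lateRegion τ₁
      rw [image_flatChart_lateRegion hU'' flat hflat hτ₁'.le]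
      exact h
    have hnh : ¬(τ₁ < p.1 0 ∧ E4.spatialNorm p.1 ≤ certRadius M (p.1 0)) := by
      intro h
      refine hp.2 (Or.inr (Set.mem_iUnion.mpr ⟨0, ?_⟩))
      change p ∈ chart '' {y | τ₁ < Bh.time y.1 ∧ Bh.radius y.1 ≤ certRadius M (Bh.time y.1)}
      rw [image_holeChart_certified chart hchart hM hτ₁'.le (fun t ↦ (certRadius_lt_exactRadius hM t).le)]
      exact h
    obtain ⟨s, hs0, hcase⟩ := exhaustion_cases hM (by linarith) hnf hnh
    refine LorentzianMetric.causalFuture_mono (singleton_subset_iff.2 ?_) (mem_causalPast_vert hM p hs0)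
    rcases hcase with ⟨h1, h2⟩ | ⟨h1, h2⟩
    · refine Or.inl ?_
      change vert p s ∈ flat '' (Minkowski.backgroundOn U'').timeSlab τ₁
      rw [image_flatChart_timeSlab hU'' flat hflat hτ₁']
      refine ⟨?_, by rw [spatialNorm_vert]; exact h2⟩
      rw [spatialNorm_vert, vert_apply_zero, ← h1]
    · refine Or.inr (Set.mem_iUnion.mpr ⟨0, ?_⟩)
      change vert p s ∈ chart '' Bh.truncTimeSlab (certRadius M τ₁) τ₁
      rw [image_holeChart_truncTimeSlab chart hchart hM hτ₁'.le (certRadius_lt_exactRadius hM τ₁).le]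
      exact ⟨by rw [vert_apply_zero, h1], by rw [spatialNorm_vert]; exact h2⟩
  -- the near-zone radii of `HasExhaustiveCharts`: `R = certRadius M + 1` (`→ ∞`, `≥ r₊ + 1 = 2M + 1`,
  -- eventually `< exactRadius M`; exhaustion by monotonicity from `certRadius M ≤ R`)
  have hRR : ∀ (_ : Fin d.N) (τ : ℝ), certRadius M τ ≤ certRadius M τ + 1 := fun _ τ ↦ by linarith
  have hRtop : Tendsto (fun τ ↦ certRadius M τ + 1) atTop atTop := by
    have h2 : Tendsto (fun τ ↦ 2 * growth M τ) atTop atTop :=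
      (tendsto_growth_atTop hM).const_mul_atTop two_pos
    refine tendsto_atTop_mono (fun τ ↦ ?_) h2
    rw [certRadius_eq]; linarith
  have hRlt : ∀ᶠ τ in atTop, certRadius M τ + 1 < exactRadius M τ := by
    filter_upwards [(tendsto_growth_atTop hM).eventually_gt_atTop (1 / 2)] with τ hτ
    rw [certRadius_eq, exactRadius_eq]; linarith
  refine ⟨O, d, fun _ ↦ by show |(0 : ℝ)| < M; rw [abs_zero]; exact hM, ?_,
    ⟨fun _ τ ↦ certRadius M τ + 1, fun _ ↦ ⟨hRtop, fun τ ↦ ?_⟩,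
      fun _ ↦ tendsto_truncDeviationCk_holeChart chart hchart hM 2 hRlt, fun τ₁ hτ₁ p hp ↦ ?_⟩⟩
  · -- `O = J⁺(Σ₀) ∩ I⁻(charted)`
    change O = (Kerr.smoothMetric M 0 (Kerr.rPlus M 0)).causalFuture (ksTime hM.le) (Set.range ψ) ∩
      (Kerr.smoothMetric M 0 (Kerr.rPlus M 0)).chronologicalPast (ksTime hM.le) d.charted
    rw [hJO]
    refine Set.Subset.antisymm (fun p hp ↦ ⟨hp, ?_⟩) inter_subset_left
    refine LorentzianMetric.chronologicalFuture_mono ?_ (hflowI p)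
    exact (Set.subset_iUnion (fun i : Fin 1 ↦ d.chart i '' (d.background i).lateRegion d.τ₀) 0).trans
      subset_union_right
  · -- `r₊ + 1 ≤ R`: `r₊(M, 0) = 2M ≤ 4M ≤ certRadius M τ`
    show max (Kerr.rPlus M 0) 0 + 1 ≤ certRadius M τ + 1
    rw [Kerr.rPlus_zero_right hM.le, max_eq_left (by positivity)]
    linarith [four_mul_le_certRadius hM τ]
  · -- exhaustion for `R = certRadius M + 1` from exhaustion for `certRadius M`, by monotonicity
    change p ∈ (Kerr.smoothMetric M 0 (Kerr.rPlus M 0)).causalPast (ksTime hM.le)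
      (certifiedSlab d (fun _ τ ↦ certRadius M τ + 1) τ₁)
    exact LorentzianMetric.causalFuture_mono (g := Kerr.smoothMetric M 0 (Kerr.rPlus M 0))
      (certifiedSlab_mono d hRR τ₁) (hexh τ₁ hτ₁ p ⟨hp.1, fun h ↦ hp.2 (certifiedLate_mono d hRR τ₁ h)⟩)

end Summit.FinalStateConjecture.FinalStateConjecture.Theorems.SwallowTheDatum.UniversalWitnessFamily

end
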